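import Summits.QuantumFields.YangMills.Theorems.BalabanUVNodesN15KingModelGraphTreeDecayPseudoforest
import Summits.QuantumFields.YangMills.Theorems.BalabanUVNodesN15KingModelRungUnit

/-!
# BalabanUVNodes ∕ N15 — THE KING-MODEL RUNG (PART Β-c): THE NODE's OWN LANGUAGE — THE TWO-LEGGED (3.56)-KERNELS OF KING's MODEL INHABIT NE2's UNIT LAYER
# `T4EtaRate.EtaRateIneqUnit` ∕ `NE2PlusUnit` (LEMMA 4.5 (4.38)'s SHAPE `C·L^{−γk}·e^{−δ|y − y′|}` FOR COMPOSITE KERNELS), AND THEOREM 3.3 (3.7)'s OPERATOR SHAPE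
# WITH THE RATE — «NE2_in_KingModel» BEYOND PROPAGATORS, BY NAME AT `A = 0`
# (Track A, DAG node N15 = NE2; FAN-OUT v1.1 §N15 s3 «KING-MODEL RUNG … NE2's analogue DECIDED in the model; the seat types `NE2_in_KingModel`»)

HONEST FRAMING.  Count-neutral (cell `pub-ymgap`, seat `pub-ymgap-dag-n15-e` g30; `--supports stmt-QuantumFields-27366 --as helper` = K3⁸
`SpineGivenEndpointR13SepCoPHV`).  TEMPLATE LITERATURE: C. King, *The U(1) Higgs model. I. The continuum limit*, Commun. Math. Phys. **102** (1986) 649–677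
[King1986]: Proposition 3.6 (3.56) p. 662 read at TWO external legs, Lemma 4.5 (4.38) p. 674 (the printed shape `CL^{−k}e^{−δ₀|x−y|}` of a unit-lattice
η-difference — the node's scalar template of record), Theorem 3.3 (3.7) p. 656 (the operator shape `C exp[−δ₀ dist(x, supp f)]‖f‖`); the NODE's predicates are
the tree's `T4EtaRate.EtaRateIneqUnit` ∕ `NE2PlusUnit` ([Balaban1985BackgroundPropagators] Thm 3.15 (3.187) p. 432 as quantifier template — HYPOTHESIS SHAPES for
Bałaban's `C^{(k)}(Λ; U)`, NOT printed), on section 2's family `kingVolInstance d L` (g0, `…N15KingModelRung`).  KING's OWN `A = 0` MODEL; NOT Bałaban's `G(U)` or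
`C^{(k)}(Λ; U)`; NOT a node discharge (N15 is booked through n15-a's knit; `S_N15 RRec` untouched); nothing continuum ∕ ℝ⁴ ∕ OS ∕ mass-gap ∕ Clay.  0 `sorry`;
standard axioms; plumbing `def`s only (the kernel written out, the `SiteKernel` bundle).  Text layer of pp. 656–675 re-read by this seat 2026-08-29.

THE PRINT.  p. 674 [PDF 26], Lemma 4.5 (4.38): *«|C^{(k)}(x, y) − C^{(k+n)}(x, y)| ≤ CL^{−k}e^{−δ₀|x−y|}»*; p. 662 [PDF 14] (3.56): *«|E^{(k)}(H̃; {y_i}, …) −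
E^{(k+n)}(H̃; …)| ≤ C … L^{−γk} exp[−δ d({y_i}, …)]»*; p. 656 [PDF 8] (3.7): *«|(G_k(Ω, A)f)(x)| ≤ C exp[−δ₀ dist(x, supp f)] ‖f‖»*.

READING (declared; ours).  A CONNECTED numbered graph `G` of King's model (`nn + 1` vertices, `m` lines `G^η_K`∕`∂^η_μG^η_K` of kinds `κ`) with TWO external legs —
King's (3.71) kernels `ℋ_K(x, y_b)`∕`∂ℋ` (parts Η-e∕Α-g `kingExtLo`∕`kingExtHi`) from the vertex `0` to the unit site `b` (kind `κ₀`) and from the vertex `v₁` to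
`b′` (kind `κ₁`) — defines the unit-lattice kernel `b, b′ ↦ E^{(K)}(G; y_b, y_{b′})`; its two-spacing difference `kingGraphPairDiff` (level `K + n` minus level
`K`, `n ≥ 1` fixed) is, by part Α-g's `king_prop36_extLegs_treeDecay_collected` at `Υ = Fin 2` and part Α-f's `exp_treeLength_le_exp_pair`, bounded by
`e^{δ}A^{2m+nn+2}·m!·(m+3) · L^{−γK} · e^{−δ|b − b′|_T}` (`|y_b − y_{b′}| ≥ |b − b′|_T − 1`, part Ψ) — LEMMA 4.5 (4.38)'s SHAPE for the composite kernel,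
uniformly in the volume.  Packaged on the family `kingVolInstance d L` (one-point backgrounds) this IS `EtaRateIneqUnit … B₀ δ L^{−γ} K` at every index, hence
`NE2PlusUnit` (`θ = L^{−γ} ∈ (0, 1)`, `a₀ = 1`, trivial regularity at `U ≡ 1`) and `NE2ZeroUnit`; for connected pseudoforests of `G`-lines in `1 ≤ d ≤ 3` with
NO hypothesis.  §5: against a bounded test function the kernel is an OPERATOR with (3.7)'s shape and the rate: `|Σ_{b′} K(b, b′)f(b′)| ≤ B₀L^{−γK}K_{d+1}(δ)‖f‖_∞`,
and `≤ B₀L^{−γK}e^{−(δ∕2)D}K_{d+1}(δ∕2)‖f‖_∞` when `f` is supported at distance `≥ D` from `b`.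

WHAT THIS FILE PROVES (namespace `Summit.QuantumFields.YangMills.BalabanUVNodes.N15KingModelRung.Curved`).  §1 `kingGraphPairDiff`, `kingGraphUnit` (objects).
§2 ★★★ **`king_graphPairDiff_le`** ((4.38)'s shape for composite kernels).  §3 ★★★ **`etaRateIneqUnit_kingGraph`**, ★★★ **`ne2PlusUnit_kingGraph`**,
★★ `ne2ZeroUnit_kingGraph`.  §4 ★★ `ne2PlusUnit_kingGraph_pseudoforest` ∕ `ne2ZeroUnit_kingGraph_pseudoforest` (no hypothesis, `1 ≤ d ≤ 3`).
§5 ★★ `king_graphPair_operator_le` ((3.7)'s shape, global), ★★ `king_graphPair_operator_supp_le` ((3.7)'s shape with `dist(b, supp f)`).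

HONEST SCOPE.  (a) The NE2 predicates are Bałaban-side HYPOTHESIS SHAPES; inhabiting them by King's composite `A = 0` kernels decides «NE2's unit layer in the
model» for the perturbative kernels of (3.56) — it says nothing about `C^{(k)}(Λ; U)` at a live background (what the curved case adds: the same inequality UNIFORMLY
over `Reg335∕Reg336 c35 α₀ U`, where print gives analyticity in `U` + η-uniformity, never an η-difference — section 3 §3 `ne2PlusUnit_iff_ne2ZeroUnit`).  (b) p. 664's
sentence is the hypothesis of §2–§3 (discharged in §4); legs = the two kernel members of (3.71); §3.5 not typed.  (c) N15 untouched; counts unmoved.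
Locators: [King1986] Thm 3.3 (3.7) p.656, Prop. 3.6 (3.56) p.662, p.664, Prop. 3.8 (3.71) p.664, Lemma 4.5 (4.38) p.674; [B9] Thm 3.15 (3.187) p.432.
-/

noncomputable section

open scoped BigOperators
open Finset

namespace Summit.QuantumFields.YangMills.BalabanUVNodes.N15KingModelRung.Curved

open Literature.MathematicalPhysics.QuantumFieldTheory.Balaban1983to89
open Literature.MathematicalPhysics.QuantumFieldTheory.Balaban1983to89.B4Sect5Proof (latticeConst latticeConst_nonneg)
open Literature.MathematicalPhysics.QuantumFieldTheory.Balaban1983to89.B5Prop11Plancherel (Tor fine)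
open Literature.MathematicalPhysics.QuantumFieldTheory.Balaban1983to89.T4EtaRate (EtaRateIneqUnit NE2PlusUnit)
open Literature.MathematicalPhysics.QuantumFieldTheory.Balaban1983to89.T4EtaRateUnitWitness (NE2ZeroUnit ne2ZeroUnit_of_ne2PlusUnit)
open Literature.MathematicalPhysics.QuantumFieldTheory.King1986.Torus (tdistT tdistT_nonneg tdistT_symm tdistT_sumBound blockOf)
open Summit.QuantumFields.YangMills.BalabanUVNodes.N15KingModelRung (KingVolIndex kingVol kingVol_neZero kingVolInstance basePt blockOf_basePt kingUnitDist)
open Summit.QuantumFields.YangMills.BalabanUVNodes.N15KingModelRung.Graph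

variable {d : ℕ} (L : ℕ) [NeZero L]

/-! ## §1 The objects: the two-legged two-spacing difference kernel and its `SiteKernel` bundle -/

section Objects

/-- **THE TWO-SPACING DIFFERENCE OF A TWO-LEGGED GRAPH KERNEL AT UNIT SITES**: `E^{(K+n)}(G; y_b, y_{b′}) − E^{(K)}(G; y_b, y_{b′})` for the numbered graph
`(nn, m, src, tgt, κ)` with King's external lines from the vertex `0` to `b` (kind `κ₀`) and from `v₁` to `b′` (kind `κ₁`).
[cite: King1986, Prop. 3.6 (3.56) p.662, Prop. 3.8 (3.71) p.664] -/
def kingGraphPairDiff (a msq : ℝ) (jv : KingVolIndex d) (n nn m : ℕ) (src tgt : Fin m → Fin (nn + 1)) (κ : Fin m → Option (Fin (d + 1)))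
    (v₁ : Fin (nn + 1)) (κ₀ κ₁ : Option (Fin (d + 1))) (b b' : Tor (kingVol L jv)) : ℝ :=
  haveI := kingVol_neZero L jv
  graphValLS ((((L : ℝ) ^ (jv.K + n))⁻¹) ^ (d + 1)) src tgt (fun ℓ => kingGLine L (kingVol L jv) a msq (jv.K + n) (κ ℓ)) ![(0 : Fin (nn + 1)), v₁]
      (fun υ => kingExtHi L a msq jv n (![b, b'] υ) (![κ₀, κ₁] υ))
    - graphValLS ((((L : ℝ) ^ jv.K)⁻¹) ^ (d + 1)) src tgt (fun ℓ => kingGLine L (kingVol L jv) a msq jv.K (κ ℓ)) ![(0 : Fin (nn + 1)), v₁]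
      (fun υ => kingExtLo L a msq jv (![b, b'] υ) (![κ₀, κ₁] υ))

/-- The same kernel as the UNIT-LAYER site kernel on section 2's family `kingVolInstance d L` (backgrounds = one point: `A = 0`).
[cite: Balaban1985BackgroundPropagators, Thm 3.15 (3.187) p.432 (shape); King1986, Prop. 3.6 (3.56) p.662 (object)] -/
def kingGraphUnit (a msq : ℝ) (n nn m : ℕ) (src tgt : Fin m → Fin (nn + 1)) (κ : Fin m → Option (Fin (d + 1)))
    (v₁ : Fin (nn + 1)) (κ₀ κ₁ : Option (Fin (d + 1))) :
    ∀ j : KingVolIndex d, B9.SiteKernel (kingVolInstance d L j).gc (kingVolInstance d L j).Bf :=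
  fun j => ⟨fun _ b b' => kingGraphPairDiff L a msq j n nn m src tgt κ v₁ κ₀ κ₁ b b'⟩

end Objects

/-! ## §2 Lemma 4.5 (4.38)'s shape for the composite kernels -/

section PairShape

/-- ★★★ **LEMMA 4.5 (4.38)'s SHAPE FOR THE TWO-LEGGED (3.56)-KERNELS, BY NAME AT `A = 0`**: for odd `L ≥ 3`, `a > 0`, `m₀² ≥ 0` there are `A ≥ 1`, `γ, δ > 0` such
that for every mass `0 < m² ≤ m₀²`, index `jv`, `n ≥ 1`, every CONNECTED numbered graph satisfying p. 664's sentence, every second-leg vertex `v₁`, leg kinds `κ₀, κ₁`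
and unit sites `b, b′`:
`|E^{(K+n)}(G; y_b, y_{b′}) − E^{(K)}(G; y_b, y_{b′})| ≤ (e^{δ}·A^{2m+nn+2}·m!·(m+3)) · L^{−γK} · e^{−δ|b − b′|_T}` — part Α-g `king_prop36_extLegs_treeDecay_collected` at
`Υ = Fin 2`, the tree decay read as pair decay (part Α-f), the base points' distance `≥ |b − b′|_T − 1` (part Ψ `mul_tdistT_blockOf_le`).
[cite: King1986, Lemma 4.5 (4.38) p.674 (shape), Prop. 3.6 (3.56) p.662, p.664, Prop. 3.8 (3.71) p.664] -/
theorem king_graphPairDiff_le (hLodd : Odd L) (hL : 2 ≤ L) {a : ℝ} (ha : 0 < a) {m0sq : ℝ} (hm0 : 0 ≤ m0sq) :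
    ∃ A γ δ : ℝ, 1 ≤ A ∧ 0 < γ ∧ 0 < δ ∧ ∀ (msq : ℝ), 0 < msq → msq ≤ m0sq → ∀ (jv : KingVolIndex d) (n : ℕ), 1 ≤ n →
      ∀ (nn m : ℕ) (src tgt : Fin m → Fin (nn + 1)), (∀ v, LConn src tgt univ 0 v) →
      ∀ (κ : Fin m → Option (Fin (d + 1))), PosSubgraphsBy src tgt 0 ((d + 1 : ℕ) : ℝ) (fun ℓ => lineExp (d + 1) (κ ℓ)) →
      ∀ (v₁ : Fin (nn + 1)) (κ₀ κ₁ : Option (Fin (d + 1))) (b b' : Tor (kingVol L jv)),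
        haveI := kingVol_neZero L jv
        |kingGraphPairDiff L a msq jv n nn m src tgt κ v₁ κ₀ κ₁ b b'|
          ≤ (Real.exp δ * A ^ (2 * m + nn + 2) * ((m.factorial : ℝ) * (m + 3))) * (L : ℝ) ^ (-(γ * jv.K))
              * Real.exp (-(δ * tdistT (kingVol L jv) b b')) := by
  obtain ⟨A, γ, δ, hA, hγ, hδ, H⟩ := king_prop36_extLegs_treeDecay_collected (d := d) L hLodd hL ha hm0
  refine ⟨A, γ, δ, hA, hγ, hδ, fun msq hm hcap jv n hn nn m src tgt hconn κ hsub v₁ κ₀ κ₁ b b' => ?_⟩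
  haveI := kingVol_neZero L jv
  have hL0 : (0 : ℝ) < L := by exact_mod_cast (show 0 < L by omega)
  have hN : (0 : ℝ) < (L : ℝ) ^ jv.K := pow_pos hL0 _
  have key := H msq hm hcap jv n hn nn m src tgt hconn κ hsub (Fin 2) ![(0 : Fin (nn + 1)), v₁] 0 (Matrix.cons_val_zero _ _) ![b, b'] ![κ₀, κ₁]
  rw [Fintype.card_fin] at key
  push_cast at key
  -- tree decay ⇒ pair decay in the unit-block distance of the base points
  have hpair := exp_treeLength_le_exp_pair L jv (fun υ : Fin 2 => some (basePt (L ^ jv.K) (kingVol L jv) (![b, b'] υ))) (υ₁ := 0) (υ₂ := 1)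
    (y₁ := basePt (L ^ jv.K) (kingVol L jv) b) (y₂ := basePt (L ^ jv.K) (kingVol L jv) b') (by simp) (by simp) hδ.le
  -- base points are at least `|b − b′|_T − 1` apart
  have hdist : tdistT (kingVol L jv) b b' ≤ kingDist L jv (basePt (L ^ jv.K) (kingVol L jv) b) (basePt (L ^ jv.K) (kingVol L jv) b') + 1 := by
    have h := mul_tdistT_blockOf_le (L ^ jv.K) (kingVol L jv) (basePt (L ^ jv.K) (kingVol L jv) b) (basePt (L ^ jv.K) (kingVol L jv) b')
    rw [blockOf_basePt, blockOf_basePt] at h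
    push_cast at h
    unfold kingDist
    rw [← sub_le_iff_le_add, le_div_iff₀ hN]
    nlinarith
  have hexp : Real.exp (-(δ * kingDist L jv (basePt (L ^ jv.K) (kingVol L jv) b) (basePt (L ^ jv.K) (kingVol L jv) b')))
      ≤ Real.exp δ * Real.exp (-(δ * tdistT (kingVol L jv) b b')) := by
    rw [← Real.exp_add]
    exact Real.exp_le_exp.2 (by nlinarith [mul_le_mul_of_nonneg_left hdist hδ.le])
  have hθ0 : 0 ≤ (L : ℝ) ^ (-(γ * jv.K)) := Real.rpow_nonneg hL0.le _
  have hC0 : 0 ≤ A ^ (2 * m + nn + 2) * ((m.factorial : ℝ) * (m + 3)) := by have := zero_le_one.trans hA; positivity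
  unfold kingGraphPairDiff
  calc _ ≤ Real.exp (-(δ * treeLength (kingDist L jv) (anchors fun υ : Fin 2 => some (basePt (L ^ jv.K) (kingVol L jv) (![b, b'] υ)))))
          * (L : ℝ) ^ (-(γ * jv.K)) * (A ^ (2 * m + nn + 2) * ((m.factorial : ℝ) * (m + 2 + 1))) := key
    _ ≤ (Real.exp δ * Real.exp (-(δ * tdistT (kingVol L jv) b b'))) * (L : ℝ) ^ (-(γ * jv.K)) * (A ^ (2 * m + nn + 2) * ((m.factorial : ℝ) * (m + 3))) := by
        rw [show ((m : ℝ) + 2 + 1) = m + 3 by ring]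
        exact mul_le_mul_of_nonneg_right (mul_le_mul_of_nonneg_right (hpair.trans hexp) hθ0) hC0
    _ = _ := by ring

end PairShape

/-! ## §3 NE2's unit layer DECIDED in the model for the composite kernels -/

section NE2

/-- ★★★ **THE TYPED UNIT INEQUALITY FOR THE COMPOSITE KERNELS**: for odd `L ≥ 3`, `a > 0`, `m₀² ≥ 0` there are `A ≥ 1`, `γ, δ > 0` such that for every mass
`0 < m² ≤ m₀²`, `n ≥ 1`, every CONNECTED numbered graph under p. 664's sentence, `v₁, κ₀, κ₁`, EVERY index `jv` and (the unique) background `U`: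
`EtaRateIneqUnit (kingGraphUnit … jv) (fun _ => True) (kingUnitDist L jv) (e^{δ}A^{2m+nn+2}m!(m+3)) δ L^{−γ} K U` — §2 with `L^{−γK} = (L^{−γ})^K` (the rate
factor IS the clean geometric rate `θ^K`).
[cite: Balaban1985BackgroundPropagators, Thm 3.15 (3.187) p.432 (shape); King1986, Lemma 4.5 (4.38) p.674, Prop. 3.6 (3.56) p.662] -/
theorem etaRateIneqUnit_kingGraph (hLodd : Odd L) (hL : 2 ≤ L) {a : ℝ} (ha : 0 < a) {m0sq : ℝ} (hm0 : 0 ≤ m0sq) :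
    ∃ A γ δ : ℝ, 1 ≤ A ∧ 0 < γ ∧ 0 < δ ∧ ∀ (msq : ℝ), 0 < msq → msq ≤ m0sq → ∀ (n : ℕ), 1 ≤ n →
      ∀ (nn m : ℕ) (src tgt : Fin m → Fin (nn + 1)), (∀ v, LConn src tgt univ 0 v) →
      ∀ (κ : Fin m → Option (Fin (d + 1))), PosSubgraphsBy src tgt 0 ((d + 1 : ℕ) : ℝ) (fun ℓ => lineExp (d + 1) (κ ℓ)) →
      ∀ (v₁ : Fin (nn + 1)) (κ₀ κ₁ : Option (Fin (d + 1))) (jv : KingVolIndex d) (U : (kingVolInstance d L jv).Bf.Cfg),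
        EtaRateIneqUnit (kingGraphUnit L a msq n nn m src tgt κ v₁ κ₀ κ₁ jv) (fun _ => True) (kingUnitDist L jv)
          (Real.exp δ * A ^ (2 * m + nn + 2) * ((m.factorial : ℝ) * (m + 3))) δ ((L : ℝ) ^ (-γ)) jv.K U := by
  obtain ⟨A, γ, δ, hA, hγ, hδ, H⟩ := king_graphPairDiff_le (d := d) L hLodd hL ha hm0
  refine ⟨A, γ, δ, hA, hγ, hδ, fun msq hm hcap n hn nn m src tgt hconn κ hsub v₁ κ₀ κ₁ jv U => ?_⟩
  intro y y' _ _
  have h := H msq hm hcap jv n hn nn m src tgt hconn κ hsub v₁ κ₀ κ₁ y y'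
  -- `L^{−γK} = (L^{−γ})^K`: the rate factor IS the clean geometric rate `θ^K`, `θ = L^{−γ}`
  have hpow : ((L : ℝ) ^ (-γ)) ^ jv.K = (L : ℝ) ^ (-(γ * jv.K)) := by
    rw [show (-(γ * jv.K) : ℝ) = (-γ) * (jv.K : ℝ) by ring, Real.rpow_mul (Nat.cast_nonneg L), Real.rpow_natCast]
  rw [hpow]
  show |kingGraphPairDiff L a msq jv n nn m src tgt κ v₁ κ₀ κ₁ y y'| ≤
    (Real.exp δ * A ^ (2 * m + nn + 2) * ((m.factorial : ℝ) * (m + 3))) * Real.exp (-(δ * (haveI := kingVol_neZero L jv; tdistT (kingVol L jv) y y')))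
      * (L : ℝ) ^ (-(γ * jv.K))
  calc _ ≤ _ := h
    _ = _ := by ring

/-- ★★★ **`NE2PlusUnit` IS INHABITED BY EVERY TWO-LEGGED (3.56)-KERNEL OF KING's MODEL — NE2's UNIT LAYER DECIDED IN THE MODEL FOR THE COMPOSITE KERNELS**
(«NE2_in_KingModel» beyond propagators): for odd `L ≥ 3`, `a > 0`, mass `0 < m² ≤ m₀²`, `n ≥ 1`, a CONNECTED numbered graph under p. 664's sentence, `v₁, κ₀, κ₁`
and every `c35`: `NE2PlusUnit c35 (kingVolInstance d L) (kingGraphUnit …) (fun _ _ => True) (kingUnitDist L)` with `(δ₀, a₀, B₀, θ) = (δ, 1, e^{δ}A^{2m+nn+2}m!(m+3), L^{−γ})`,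
uniform in the index (volume `2L^m`, scales `K`, size letter).  HONEST: backgrounds range over `{U ≡ 1}`; Bałaban's `C^{(k)}(Λ; U)` untouched.
[cite: Balaban1985BackgroundPropagators, Thm 3.15 (3.187) p.432 (quantifier template); King1986, Prop. 3.6 (3.56) p.662, Lemma 4.5 (4.38) p.674] -/
theorem ne2PlusUnit_kingGraph (hLodd : Odd L) (hL : 2 ≤ L) {a : ℝ} (ha : 0 < a) {m0sq msq : ℝ} (hm0 : 0 ≤ m0sq) (hm : 0 < msq) (hcap : msq ≤ m0sq)
    {n : ℕ} (hn : 1 ≤ n) {nn m : ℕ} {src tgt : Fin m → Fin (nn + 1)} (hconn : ∀ v, LConn src tgt univ 0 v)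
    {κ : Fin m → Option (Fin (d + 1))} (hsub : PosSubgraphsBy src tgt 0 ((d + 1 : ℕ) : ℝ) (fun ℓ => lineExp (d + 1) (κ ℓ)))
    (v₁ : Fin (nn + 1)) (κ₀ κ₁ : Option (Fin (d + 1))) (c35 : ℝ) :
    NE2PlusUnit c35 (kingVolInstance d L) (kingGraphUnit L a msq n nn m src tgt κ v₁ κ₀ κ₁) (fun _ _ => True) (kingUnitDist L) := by
  obtain ⟨A, γ, δ, hA, hγ, hδ, H⟩ := etaRateIneqUnit_kingGraph (d := d) L hLodd hL ha hm0
  have hL1r : (1 : ℝ) < L := by exact_mod_cast (show 1 < L by omega)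
  have hθ0 : 0 < (L : ℝ) ^ (-γ) := Real.rpow_pos_of_pos (by linarith) _
  have hθ1 : (L : ℝ) ^ (-γ) < 1 := Real.rpow_lt_one_of_one_lt_of_neg hL1r (by linarith)
  have hB : 0 < Real.exp δ * A ^ (2 * m + nn + 2) * ((m.factorial : ℝ) * (m + 3)) := by
    have := zero_le_one.trans hA
    have hf : (0 : ℝ) < m.factorial := by exact_mod_cast m.factorial_pos
    positivity
  exact ⟨δ, 1, Real.exp δ * A ^ (2 * m + nn + 2) * ((m.factorial : ℝ) * (m + 3)), (L : ℝ) ^ (-γ), hδ, one_pos, hB, hθ0, hθ1,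
    fun jv _ _ _ U _ _ => H msq hm hcap n hn nn m src tgt hconn κ hsub v₁ κ₀ κ₁ jv U⟩

/-- ★★ **`NE2ZeroUnit` HOLDS FOR THE COMPOSITE KERNELS** (same data): the lineage's `ne2ZeroUnit_of_ne2PlusUnit` (sizes `Msz ≥ 1 > 0`, trivial regularity at
`U ≡ 1`). [cite: King1986, Prop. 3.6 (3.56) p.662 (A = 0 model), Lemma 4.5 (4.38) p.674] -/
theorem ne2ZeroUnit_kingGraph (hLodd : Odd L) (hL : 2 ≤ L) {a : ℝ} (ha : 0 < a) {m0sq msq : ℝ} (hm0 : 0 ≤ m0sq) (hm : 0 < msq) (hcap : msq ≤ m0sq)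
    {n : ℕ} (hn : 1 ≤ n) {nn m : ℕ} {src tgt : Fin m → Fin (nn + 1)} (hconn : ∀ v, LConn src tgt univ 0 v)
    {κ : Fin m → Option (Fin (d + 1))} (hsub : PosSubgraphsBy src tgt 0 ((d + 1 : ℕ) : ℝ) (fun ℓ => lineExp (d + 1) (κ ℓ)))
    (v₁ : Fin (nn + 1)) (κ₀ κ₁ : Option (Fin (d + 1))) :
    NE2ZeroUnit (kingVolInstance d L) (kingGraphUnit L a msq n nn m src tgt κ v₁ κ₀ κ₁) (fun _ _ => True) (kingUnitDist L) :=
  ne2ZeroUnit_of_ne2PlusUnit (c35 := 0) (fun j => lt_of_lt_of_le one_pos j.one_le_Msz) (fun _ _ _ => trivial)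
    (fun _ _ _ => trivial) (ne2PlusUnit_kingGraph L hLodd hL ha hm0 hm hcap hn hconn hsub v₁ κ₀ κ₁ 0)

end NE2

/-! ## §4 The hypothesis-free class: connected pseudoforests of `G`-lines, `1 ≤ d ≤ 3` -/

section Pseudoforest

/-- ★★ **NE2's UNIT LAYER FOR EVERY TWO-LEGGED CONNECTED PSEUDOFOREST OF `G`-LINES — NO HYPOTHESIS** (`1 ≤ d ≤ 3`; no tadpole, no parallel pair: all connected
trees and one-loop graphs): p. 664's sentence discharged by part Δ-c's counting (part Α-p `posSubgraphsBy_lineExp_pseudoforest`).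
[cite: King1986, Prop. 3.6 (3.56) p.662, p.664, Lemma 4.5 (4.38) p.674] -/
theorem ne2PlusUnit_kingGraph_pseudoforest (hd1 : 1 ≤ d) (hd3 : d ≤ 3) (hLodd : Odd L) (hL : 2 ≤ L) {a : ℝ} (ha : 0 < a) {m0sq msq : ℝ}
    (hm0 : 0 ≤ m0sq) (hm : 0 < msq) (hcap : msq ≤ m0sq) {n : ℕ} (hn : 1 ≤ n) {nn m : ℕ} {src tgt : Fin m → Fin (nn + 1)}
    (hconn : ∀ v, LConn src tgt univ 0 v) (h1 : ∀ ℓ, src ℓ ≠ tgt ℓ) (h2 : ∀ S : Finset (Fin m), S.card ≤ (lineVerts src tgt S).card)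
    (h3 : ∀ S : Finset (Fin m), S.card = 2 → 3 ≤ (lineVerts src tgt S).card) (v₁ : Fin (nn + 1)) (κ₀ κ₁ : Option (Fin (d + 1))) (c35 : ℝ) :
    NE2PlusUnit c35 (kingVolInstance d L) (kingGraphUnit L a msq n nn m src tgt (fun _ => none) v₁ κ₀ κ₁) (fun _ _ => True) (kingUnitDist L) :=
  ne2PlusUnit_kingGraph L hLodd hL ha hm0 hm hcap hn hconn (posSubgraphsBy_lineExp_pseudoforest hd1 hd3 h1 h2 h3) v₁ κ₀ κ₁ c35

/-- ★★ `NE2ZeroUnit` for every two-legged connected pseudoforest of `G`-lines, no hypothesis (`1 ≤ d ≤ 3`). [cite: King1986, Prop. 3.6 (3.56) p.662, p.664] -/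
theorem ne2ZeroUnit_kingGraph_pseudoforest (hd1 : 1 ≤ d) (hd3 : d ≤ 3) (hLodd : Odd L) (hL : 2 ≤ L) {a : ℝ} (ha : 0 < a) {m0sq msq : ℝ}
    (hm0 : 0 ≤ m0sq) (hm : 0 < msq) (hcap : msq ≤ m0sq) {n : ℕ} (hn : 1 ≤ n) {nn m : ℕ} {src tgt : Fin m → Fin (nn + 1)}
    (hconn : ∀ v, LConn src tgt univ 0 v) (h1 : ∀ ℓ, src ℓ ≠ tgt ℓ) (h2 : ∀ S : Finset (Fin m), S.card ≤ (lineVerts src tgt S).card)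
    (h3 : ∀ S : Finset (Fin m), S.card = 2 → 3 ≤ (lineVerts src tgt S).card) (v₁ : Fin (nn + 1)) (κ₀ κ₁ : Option (Fin (d + 1))) :
    NE2ZeroUnit (kingVolInstance d L) (kingGraphUnit L a msq n nn m src tgt (fun _ => none) v₁ κ₀ κ₁) (fun _ _ => True) (kingUnitDist L) :=
  ne2ZeroUnit_kingGraph L hLodd hL ha hm0 hm hcap hn hconn (posSubgraphsBy_lineExp_pseudoforest hd1 hd3 h1 h2 h3) v₁ κ₀ κ₁

end Pseudoforest

/-! ## §5 Theorem 3.3 (3.7)'s operator shape with the rate, for the composite kernels -/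

section Operator

/-- ★★ **THE COMPOSITE KERNEL AS AN OPERATOR ON BOUNDED UNIT-LATTICE FUNCTIONS** (Thm 3.3 (3.7)'s shape, global form, with the rate): with §2's `(A, γ, δ)`, for
every test function `|f| ≤ Φ` and unit site `b`: `|Σ_{b′} [E^{(K+n)} − E^{(K)}](G; y_b, y_{b′})·f(b′)| ≤ (e^{δ}A^{2m+nn+2}m!(m+3)) · L^{−γK} · K_{d+1}(δ) · Φ`
(`K_{d+1}` = the tree's `latticeConst`, `tdistT_sumBound`), uniformly in the volume. [cite: King1986, Thm 3.3 (3.7) p.656 (shape), Prop. 3.6 (3.56) p.662, (3.68) p.664] -/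
theorem king_graphPair_operator_le (hLodd : Odd L) (hL : 2 ≤ L) {a : ℝ} (ha : 0 < a) {m0sq : ℝ} (hm0 : 0 ≤ m0sq) :
    ∃ A γ δ : ℝ, 1 ≤ A ∧ 0 < γ ∧ 0 < δ ∧ ∀ (msq : ℝ), 0 < msq → msq ≤ m0sq → ∀ (jv : KingVolIndex d) (n : ℕ), 1 ≤ n →
      ∀ (nn m : ℕ) (src tgt : Fin m → Fin (nn + 1)), (∀ v, LConn src tgt univ 0 v) →
      ∀ (κ : Fin m → Option (Fin (d + 1))), PosSubgraphsBy src tgt 0 ((d + 1 : ℕ) : ℝ) (fun ℓ => lineExp (d + 1) (κ ℓ)) →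
      ∀ (v₁ : Fin (nn + 1)) (κ₀ κ₁ : Option (Fin (d + 1))) (Φ : ℝ), 0 ≤ Φ → ∀ (f : Tor (kingVol L jv) → ℝ), (∀ b', |f b'| ≤ Φ) →
      ∀ b : Tor (kingVol L jv),
        haveI := kingVol_neZero L jv
        |∑ b' : Tor (kingVol L jv), kingGraphPairDiff L a msq jv n nn m src tgt κ v₁ κ₀ κ₁ b b' * f b'|
          ≤ (Real.exp δ * A ^ (2 * m + nn + 2) * ((m.factorial : ℝ) * (m + 3))) * (L : ℝ) ^ (-(γ * jv.K)) * latticeConst (d + 1) δ * Φ := by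
  obtain ⟨A, γ, δ, hA, hγ, hδ, H⟩ := king_graphPairDiff_le (d := d) L hLodd hL ha hm0
  refine ⟨A, γ, δ, hA, hγ, hδ, fun msq hm hcap jv n hn nn m src tgt hconn κ hsub v₁ κ₀ κ₁ Φ hΦ f hf b => ?_⟩
  haveI := kingVol_neZero L jv
  have hL0 : (0 : ℝ) < L := by exact_mod_cast (show 0 < L by omega)
  set B : ℝ := (Real.exp δ * A ^ (2 * m + nn + 2) * ((m.factorial : ℝ) * (m + 3))) * (L : ℝ) ^ (-(γ * jv.K)) with hB
  have hB0 : 0 ≤ B := by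
    have := zero_le_one.trans hA
    have := Real.rpow_nonneg hL0.le (-(γ * jv.K))
    positivity
  have hterm : ∀ b' : Tor (kingVol L jv), |kingGraphPairDiff L a msq jv n nn m src tgt κ v₁ κ₀ κ₁ b b' * f b'|
      ≤ B * Real.exp (-(δ * tdistT (kingVol L jv) b b')) * Φ := fun b' => by
    rw [abs_mul]
    exact mul_le_mul (H msq hm hcap jv n hn nn m src tgt hconn κ hsub v₁ κ₀ κ₁ b b') (hf b') (abs_nonneg _)
      (mul_nonneg hB0 (Real.exp_nonneg _))
  refine (abs_sum_le_sum_abs _ _).trans ((sum_le_sum fun b' _ => hterm b').trans ?_)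
  rw [← sum_mul, ← mul_sum]
  exact mul_le_mul_of_nonneg_right (mul_le_mul_of_nonneg_left (tdistT_sumBound (kingVol L jv) δ hδ b) hB0) hΦ

/-- ★★ **THEOREM 3.3 (3.7)'s SHAPE `C exp[−δ₀ dist(x, supp f)]‖f‖` WITH THE RATE, FOR THE COMPOSITE KERNELS**: with §2's `(A, γ, δ)`, if `|f| ≤ Φ`, `f` vanishes
off a set `S` and `dist(b, S) ≥ D ≥ 0` (`D ≤ |b − b′|_T` for `b′ ∈ S`), then
`|Σ_{b′} [E^{(K+n)} − E^{(K)}](G; y_b, y_{b′})·f(b′)| ≤ (e^{δ}A^{2m+nn+2}m!(m+3)) · L^{−γK} · e^{−(δ∕2)D} · K_{d+1}(δ∕2) · Φ` — half of the pair decay pays the distance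
to the support, the other half the sum. [cite: King1986, Thm 3.3 (3.7) p.656 (shape), Prop. 3.6 (3.56) p.662, (3.67)–(3.68) p.664] -/
theorem king_graphPair_operator_supp_le (hLodd : Odd L) (hL : 2 ≤ L) {a : ℝ} (ha : 0 < a) {m0sq : ℝ} (hm0 : 0 ≤ m0sq) :
    ∃ A γ δ : ℝ, 1 ≤ A ∧ 0 < γ ∧ 0 < δ ∧ ∀ (msq : ℝ), 0 < msq → msq ≤ m0sq → ∀ (jv : KingVolIndex d) (n : ℕ), 1 ≤ n →
      ∀ (nn m : ℕ) (src tgt : Fin m → Fin (nn + 1)), (∀ v, LConn src tgt univ 0 v) →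
      ∀ (κ : Fin m → Option (Fin (d + 1))), PosSubgraphsBy src tgt 0 ((d + 1 : ℕ) : ℝ) (fun ℓ => lineExp (d + 1) (κ ℓ)) →
      ∀ (v₁ : Fin (nn + 1)) (κ₀ κ₁ : Option (Fin (d + 1))) (Φ : ℝ), 0 ≤ Φ → ∀ (f : Tor (kingVol L jv) → ℝ), (∀ b', |f b'| ≤ Φ) →
      ∀ (S : Finset (Tor (kingVol L jv))), (∀ b', b' ∉ S → f b' = 0) →
      ∀ (b : Tor (kingVol L jv)) (D : ℝ), 0 ≤ D →
        (haveI := kingVol_neZero L jv; ∀ b' ∈ S, D ≤ tdistT (kingVol L jv) b b') →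
        haveI := kingVol_neZero L jv
        |∑ b' : Tor (kingVol L jv), kingGraphPairDiff L a msq jv n nn m src tgt κ v₁ κ₀ κ₁ b b' * f b'|
          ≤ (Real.exp δ * A ^ (2 * m + nn + 2) * ((m.factorial : ℝ) * (m + 3))) * (L : ℝ) ^ (-(γ * jv.K))
              * Real.exp (-(δ / 2 * D)) * latticeConst (d + 1) (δ / 2) * Φ := by
  obtain ⟨A, γ, δ, hA, hγ, hδ, H⟩ := king_graphPairDiff_le (d := d) L hLodd hL ha hm0
  refine ⟨A, γ, δ, hA, hγ, hδ, fun msq hm hcap jv n hn nn m src tgt hconn κ hsub v₁ κ₀ κ₁ Φ hΦ f hf S hS b D hD hDist => ?_⟩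
  haveI := kingVol_neZero L jv
  have hL0 : (0 : ℝ) < L := by exact_mod_cast (show 0 < L by omega)
  have hδ2 : 0 < δ / 2 := half_pos hδ
  set B : ℝ := (Real.exp δ * A ^ (2 * m + nn + 2) * ((m.factorial : ℝ) * (m + 3))) * (L : ℝ) ^ (-(γ * jv.K)) with hB
  have hB0 : 0 ≤ B := by
    have := zero_le_one.trans hA
    have := Real.rpow_nonneg hL0.le (-(γ * jv.K))
    positivity
  -- on the support: `e^{−δt} ≤ e^{−(δ/2)D}·e^{−(δ/2)t}`; off the support the term vanishes
  have hterm : ∀ b' : Tor (kingVol L jv), |kingGraphPairDiff L a msq jv n nn m src tgt κ v₁ κ₀ κ₁ b b' * f b'|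
      ≤ B * Real.exp (-(δ / 2 * D)) * Φ * Real.exp (-(δ / 2 * tdistT (kingVol L jv) b b')) := fun b' => by
    by_cases hb' : b' ∈ S
    · have ht := hDist b' hb'
      have hsplit : Real.exp (-(δ * tdistT (kingVol L jv) b b'))
          ≤ Real.exp (-(δ / 2 * D)) * Real.exp (-(δ / 2 * tdistT (kingVol L jv) b b')) := by
        rw [← Real.exp_add]
        exact Real.exp_le_exp.2 (by nlinarith)
      rw [abs_mul]
      calc |kingGraphPairDiff L a msq jv n nn m src tgt κ v₁ κ₀ κ₁ b b'| * |f b'|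
          ≤ (B * Real.exp (-(δ * tdistT (kingVol L jv) b b'))) * Φ :=
            mul_le_mul (H msq hm hcap jv n hn nn m src tgt hconn κ hsub v₁ κ₀ κ₁ b b') (hf b') (abs_nonneg _) (mul_nonneg hB0 (Real.exp_nonneg _))
        _ ≤ (B * (Real.exp (-(δ / 2 * D)) * Real.exp (-(δ / 2 * tdistT (kingVol L jv) b b')))) * Φ :=
            mul_le_mul_of_nonneg_right (mul_le_mul_of_nonneg_left hsplit hB0) hΦ
        _ = _ := by ring
    · rw [hS b' hb', mul_zero, abs_zero]
      have := Real.exp_nonneg (-(δ / 2 * D))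
      have := Real.exp_nonneg (-(δ / 2 * tdistT (kingVol L jv) b b'))
      positivity
  refine (abs_sum_le_sum_abs _ _).trans ((sum_le_sum fun b' _ => hterm b').trans ?_)
  rw [← mul_sum]
  have hK := tdistT_sumBound (kingVol L jv) (δ / 2) hδ2 b
  have hpre : 0 ≤ B * Real.exp (-(δ / 2 * D)) * Φ := by have := Real.exp_nonneg (-(δ / 2 * D)); positivity
  calc B * Real.exp (-(δ / 2 * D)) * Φ * ∑ b' : Tor (kingVol L jv), Real.exp (-(δ / 2 * tdistT (kingVol L jv) b b'))
      ≤ B * Real.exp (-(δ / 2 * D)) * Φ * latticeConst (d + 1) (δ / 2) := mul_le_mul_of_nonneg_left hK hpre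
    _ = _ := by ring

end Operator

end Summit.QuantumFields.YangMills.BalabanUVNodes.N15KingModelRung.Curved

end
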